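import Literature.AnabelianGeometry.SemiGraphs.PSCSeparatingCoveringsBoundaryNode
import Literature.AnabelianGeometry.SemiGraphs.PSCTwoComponentUnmarkedProp12All
import Literature.AnabelianGeometry.SemiGraphs.ProSigmaHeisenbergSeparation
import Literature.GroupTheory.CombinatorialGroupTheory.PuncturedSurfaceGroupClosedComponentEmbedding
import HarnessLib

/-!
# [CombGC] Prop. 1.2, proof p. 9: EDGE-LIKE separating coverings at two-component data with `C₁` UNMARKED and ONE marked point (rows F-2827, F-2829, F-2830)

Mochizuki, *A combinatorial version of the Grothendieck conjecture*, Tohoku Math. J. **59** (2007)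
[CombGC], PROOF of Proposition 1.2, author's manuscript p. 9, the resp'd (edge) case: "there exists a
finite étale … `Π_G`-covering `G' → G` whose restriction to the anabelioid `G_{e₂}` is trivial …, but whose
restriction to the anabelioid `G_{e₁}` is nontrivial" [cite: MochizukiCombGC2007, Prop 1.2 proof p.9]; typed
LEVEL-WISE as `PSCDatum.EdgeLikeSeparatingCoverings` (abc-iut-w4-d081, row P12-L01-E; abc-iut FACT-LIST
row F-2827, the edge conjunct of F-2829 / F-2830 — schemata whose universal closures are refuted as typed;
the instance forms at genuine carriers are the content).

PROOF-ONLY file (abc-iut-f-166 gen 6, row «ONE-CUSP-CORNERS» (2); 0 definitions).  The carrier: the datum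
of two-component shape with `C₁` UNMARKED (`s = 0`) and EXACTLY ONE marked point (`r = 1`, on `C₀`; both
genera positive by stability) over a profinite pro-`Σ` completion `ι : Γ_{g₀+g₁,1} → Π` — the corner left
open by gen 5's level route (`PSCSeparatingCoveringsTwoComponentUnmarkedEdges.lean`, `r ≥ 2`).  Here
`Γ_{g,1}` is free on the handles and BOTH edge generators are boundary words: the cusp
`c₀ = (∏_i [a_i,b_i])⁻¹` and the node loop `ε = c₀ ∏_{i<g₀}[a_i,b_i] = (∏_{i≥g₀}[a_i,b_i])⁻¹`; they agree
modulo `[Γ,Γ]`-factors that every abelian character kills, so NO abelian certificate separates a level node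
from a level cusp.  The four kinds of pairs of level edges are separated as follows:

* node / node — abc-iut-f-164's boundary-node theorem `boundaryNode_exists_open_separating_sameEdge` for
  the free factor `B = ⟨a_i, b_i : i ≥ g₀⟩ ≅ Γ_{g₁,1}` (`exists_hom_closedComponent`, `c₀ ↦ ε`);
* cusp / cusp — the SAME theorem for the improper free factor `B = Γ_{g,1} ≅ Γ_{g,1}` itself (`θ = id`,
  `c₀ ↦ c₀`: the lone cusp is the boundary of the whole once-punctured surface);
* node alive / cusp killed, cusp alive / node killed — the NON-ABELIAN twin
  `IsProSigmaCompletion.exists_open_separating_of_hom` (this file) of abc-iut-f-164's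
  `exists_open_separating_of_character`: a homomorphism `φ : Γ → M` to a finite `Σ`-group killing the
  generator of the killed edge, with `φ(x)^{[Π:V]} ≠ 1` for the generator `x` of the alive edge, extends
  continuously to `Π` and `U := V ∩ Ker` separates; the homomorphisms are gen 2's Heisenberg
  assignments mod `ℓ^{[Π:V]}` (`exists_hom_two_handles`: `(a₀,b₀,a_{g₀},b_{g₀}) ↦ (X,Y,Y,X)`, kills `c₀`,
  `ε ↦ [X,Y] = Z`; `exists_hom_handle_cusp`: `(a₀,b₀,c₀) ↦ (X,Y,Z⁻¹)`, kills `ε`, `c₀ ↦ Z⁻¹`).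

* `edgeLikeSeparatingCoverings_of_twoComponentUnmarked_oneCusp` — **F-2827** (`V' := V`) at EVERY such
  datum; `edgeLikeSeparatingCoverings_of_twoComponentUnmarked'` — F-2827 at every unmarked-`C₁` datum with
  `r ≥ 1` (gen 5's theorem for `r ≥ 2` BY NAME);
* `separatingCoverings_of_twoComponentUnmarked'` — **F-2829** (all three conjuncts) at every unmarked-`C₁`
  datum, `r ≥ 1` (abc-iut-f-164's F-2826 `verticialSeparatingCoverings_of_twoComponentUnmarked` and F-2828
  `unrRows_of_twoComponent` BY NAME);
* origin rows (F-2830 at every unmarked-`C₁` origin with `r ≥ 1`, F-2830 ∧ F-0459 ∧ F-0438, non-vacuity at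
  `Γ_{2,1}`): the sequel `PSCSeparatingCoveringsTwoComponentUnmarkedOrigin.lean`.

With the affine / pointed / closed-surface files this completes rows F-2826–F-2830 at EVERY stable
two-component ONE-node datum of the cell's typing.  Instance forms at data of the shape of genuine
two-component curves: consistency evidence for the typed schemata, not the printed theorem for all pointed
stable curves (cell FOUNDATIONS rows 13–14).  Nothing here takes a side on [IUTchIII] Cor. 3.12.
-/

noncomputable section

namespace Literature.AnabelianGeometry.SemiGraphs

open scoped Pointwise
open Literature.AnabelianGeometry.Anabelioids (IsSigmaInteger)
open Literature.GroupTheory.CombinatorialGroupTheory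

/-! ### The non-abelian cross-pair engine -/

namespace SemiGraphOfAnabelioids.IsProSigmaCompletion

variable {Sigma : Set ℕ} {Γ : Type*} [Group Γ] {P : Type*} [Group P] [TopologicalSpace P]
  [IsTopologicalGroup P] [CompactSpace P] [TotallyDisconnectedSpace P] {ι : Γ →* P}

/-- **[CombGC] Prop. 1.2, proof p. 9 — separating a level edge from a DIFFERENT level edge by a finite
non-abelian quotient.**  `ι : Γ → Π` a profinite pro-`Σ` completion, `M` a finite group of `Σ`-integer
order, `φ : Γ → M` a homomorphism killing a subgroup `H₂` with `A₂ = cl ι(H₂)`, `A₁ ≤ Π` containing some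
`ι(a)`, `V ⊴ Π` open with `φ(a)^{[Π:V]} ≠ 1`.  Then for ALL `γ₁, γ₂` there is an open `U ≤ V`, normal in
`V`, with `γ₂A₂γ₂⁻¹ ∩ V ≤ U` and `γ₁A₁γ₁⁻¹ ∩ V ⊄ U`: the continuous extension `F : Π → M` of `φ` kills
`A₂` and every conjugate, while `F(γ₁ ι(a)^{[Π:V]} γ₁⁻¹)` is conjugate to `φ(a)^{[Π:V]} ≠ 1`;
`U := V ∩ Ker F`.  (abc-iut-f-164's `exists_open_separating_of_character` is the case `M = ℤ/ℓⁿ`.)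
[cite: MochizukiCombGC2007, Prop 1.2 proof p.9] -/
theorem exists_open_separating_of_hom (hι : IsProSigmaCompletion Sigma ι)
    {M : Type*} [Group M] [Finite M] (hM : IsSigmaInteger Sigma (Nat.card M)) (φ : Γ →* M)
    (A₂ : Subgroup P) (H₂ : Subgroup Γ) (hA₂ : A₂ = (H₂.map ι).topologicalClosure)
    (hφ₂ : ∀ x ∈ H₂, φ x = 1) (A₁ : Subgroup P) (a : Γ) (haA : ι a ∈ A₁)
    (V : Subgroup P) [hVn : V.Normal] (hVo : IsOpen (V : Set P)) (hφa : φ a ^ V.index ≠ 1)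
    (γ₁ γ₂ : ConjAct P) :
    ∃ U : Subgroup P, IsOpen (U : Set P) ∧ U ≤ V ∧ (U.subgroupOf V).Normal ∧
      (γ₂ • A₂) ⊓ V ≤ U ∧ ¬ ((γ₁ • A₁) ⊓ V ≤ U) := by
  classical
  have hVi : IsSigmaInteger Sigma V.index := hι.index_open V hVn hVo
  haveI : V.FiniteIndex := ⟨hVi.1.ne'⟩
  set m : ℕ := V.index with hm
  set y : Γ := a ^ m with hy
  have hyV : ι y ∈ V := by rw [hy, map_pow]; exact Subgroup.pow_index_mem V (ι a)
  have hyA : ι y ∈ A₁ := by rw [hy, map_pow]; exact A₁.pow_mem haA m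
  have hφy : φ y ≠ 1 := by rw [hy, map_pow]; exact hφa
  -- the continuous extension `F` of `φ`
  letI : TopologicalSpace M := ⊥
  haveI : DiscreteTopology M := ⟨rfl⟩
  obtain ⟨F, hFc, hF⟩ := exists_continuous_extend_top hι hM φ
  have hkero : IsOpen ((F.ker : Subgroup P) : Set P) := by
    have hker : ((F.ker : Subgroup P) : Set P) = F ⁻¹' {1} := by
      ext x
      simp only [SetLike.mem_coe, MonoidHom.mem_ker, Set.mem_preimage, Set.mem_singleton_iff]
    rw [hker]
    exact (isOpen_discrete _).preimage hFc
  have hA₂ker : A₂ ≤ F.ker := by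
    rw [hA₂]
    refine Subgroup.topologicalClosure_minimal _ ?_ (Subgroup.isClosed_of_isOpen _ hkero)
    rintro _ ⟨x, hx, rfl⟩
    rw [MonoidHom.mem_ker, hF x]
    exact hφ₂ x hx
  -- `U := V ∩ Ker F`
  refine ⟨V ⊓ F.ker, hVo.inter hkero, inf_le_left, ?_, ?_, ?_⟩
  · rw [Subgroup.inf_subgroupOf_left]
    infer_instance
  · refine le_inf inf_le_right (inf_le_left.trans ?_)
    rw [← (inferInstance : F.ker.Normal).conjAct γ₂]
    exact Subgroup.pointwise_smul_le_pointwise_smul_iff.mpr hA₂ker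
  · intro hle
    apply hφy
    have hz : ConjAct.ofConjAct γ₁ * ι y * (ConjAct.ofConjAct γ₁)⁻¹ ∈ (γ₁ • A₁) ⊓ V := by
      refine Subgroup.mem_inf.mpr ⟨?_, hVn.conj_mem _ hyV _⟩
      have h := Subgroup.smul_mem_pointwise_smul (ι y) γ₁ A₁ hyA
      rwa [ConjAct.smul_def] at h
    have hker := (Subgroup.mem_inf.mp (hle hz)).2
    rw [MonoidHom.mem_ker, map_mul, map_mul, map_inv, mul_inv_eq_one, mul_eq_left, hF y] at hker
    exact hker

end SemiGraphOfAnabelioids.IsProSigmaCompletion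

/-! ### F-2827 at the unmarked-`C₁` datum with one marked point -/

namespace PSCDatum

open Literature.GroupTheory.CombinatorialGroupTheory.PuncturedSurfaceGroup (a b c cuspInertia
  exists_freeGroupBasis_elim_zero exists_hom_closedComponent exists_hom_two_handles hom_two_handles_nodeLoop
  exists_hom_handle_cusp hom_handle_cusp_nodeLoop)
open Literature.GroupTheory.CombinatorialGroupTheory.FreeFactorFibredTwist (mem_closure_range_basis)
open SemiGraphOfAnabelioids (IsProSigmaCompletion)
open SemiGraphOfAnabelioids.IsProSigmaCompletion (boundaryNode_exists_open_separating_sameEdge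
  exists_open_separating_of_hom)

section Datum

variable {P : Type} [Group P] [TopologicalSpace P] [IsTopologicalGroup P]
variable [CompactSpace P] [TotallyDisconnectedSpace P] {Sigma : Set ℕ} {g r : ℕ}

/-- **Row P12-L01-E / F-2827 (`EdgeLikeSeparatingCoverings`, `V' := V`) at EVERY two-component datum
with `C₁` UNMARKED and ONE marked point** (`s = 0`, `r = 1`, `1 ≤ g₀`, `1 ≤ g − g₀`; gen-2 shape
hypotheses verbatim): node/node and cusp/cusp pairs of level edges by the boundary-node theorem (for the
free factor `⟨a_i,b_i : i ≥ g₀⟩`, resp. for `Γ_{g,1}` itself), the two mixed pairs by Heisenberg quotients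
mod `ℓ^{[Π:V]}` through `exists_open_separating_of_hom`.
[cite: MochizukiCombGC2007, Prop 1.2 proof p.9] -/
theorem edgeLikeSeparatingCoverings_of_twoComponentUnmarked_oneCusp (hne : Sigma.Nonempty)
    (hprime : ∀ p ∈ Sigma, p.Prime) (ι : PuncturedSurfaceGroup g r →* P)
    (hι : IsProSigmaCompletion Sigma ι) (G : PSCDatum P) {g₀ s : ℕ} (hs : s = 0) (hr : r = 1)
    (hg₀1 : 1 ≤ g₀) (hg₁ : 1 ≤ g - g₀) (e : G.graph.C ≃ Fin r)
    (hC : ∀ c', G.cuspGp c' = ((cuspInertia (g := g) (e c')).map ι).topologicalClosure)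
    (ε : PuncturedSurfaceGroup g r)
    (hε : ε = ((List.finRange r).map fun j : Fin r =>
          if s ≤ (j : ℕ) then PuncturedSurfaceGroup.c (g := g) j else 1).prod *
        ((List.finRange g).map fun i : Fin g => if (i : ℕ) < g₀ then
          PuncturedSurfaceGroup.a (r := r) i * PuncturedSurfaceGroup.b i *
            (PuncturedSurfaceGroup.a i)⁻¹ * (PuncturedSurfaceGroup.b i)⁻¹ else 1).prod)
    (n₀ : G.graph.N) (hN : ∀ n, n = n₀)
    (hE : G.nodeGp n₀ = ((Subgroup.zpowers ε).map ι).topologicalClosure) :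
    G.EdgeLikeSeparatingCoverings := by
  classical
  subst hs hr
  obtain ⟨g₁, rfl⟩ : ∃ g₁, g = g₀ + g₁ := ⟨g - g₀, by omega⟩
  have hg₁' : 1 ≤ g₁ := by omega
  obtain ⟨ℓ, hℓS⟩ := hne
  have hℓ : ℓ.Prime := hprime ℓ hℓS
  -- the free basis `{a_i, b_i}` of `Γ_{g,1}` and the closed component `B = ⟨a_i, b_i : i ≥ g₀⟩ ≅ Γ_{g₁,1}`
  obtain ⟨b₀, ha₀, hb₀, -⟩ := exists_freeGroupBasis_elim_zero (g₀ + g₁) 0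
  obtain ⟨θ, hθinj, -, -, hθc, hθrange⟩ :=
    exists_hom_closedComponent (g₀ := g₀) (g₁ := g₁) (r' := 0) ε hε
  set S_B : Set ((Fin (g₀ + g₁) × Bool) ⊕ Fin 0) :=
    {x | Sum.elim (fun p : Fin (g₀ + g₁) × Bool => g₀ ≤ (p.1 : ℕ)) (fun _ : Fin 0 => False) x} with hS_B
  have himg : b₀ '' S_B = {x | ∃ i : Fin (g₀ + g₁), g₀ ≤ (i : ℕ) ∧ (x = a i ∨ x = b i)} := by
    ext x
    constructor
    · rintro ⟨y, hy, rfl⟩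
      rcases y with ⟨i, _ | _⟩ | j
      · exact ⟨i, hy, Or.inl (ha₀ i)⟩
      · exact ⟨i, hy, Or.inr (hb₀ i)⟩
      · exact j.elim0
    · rintro ⟨i, hi, rfl | rfl⟩
      · exact ⟨Sum.inl (i, false), hi, ha₀ i⟩
      · exact ⟨Sum.inl (i, true), hi, hb₀ i⟩
  have hθB : θ.range = Subgroup.closure (b₀ '' S_B) := by rw [hθrange, himg]
  have hidB : (MonoidHom.id (PuncturedSurfaceGroup (g₀ + g₁) 1)).range =
      Subgroup.closure (b₀ '' Set.univ) := by
    ext x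
    exact ⟨fun _ => by rw [Set.image_univ]; exact mem_closure_range_basis b₀ x, fun _ => ⟨x, rfl⟩⟩
  -- the edge groups
  have hc0 : ∀ c', e c' = 0 := fun c' => Fin.fin_one_eq_zero (e c')
  have hEn : ∀ n, G.edgeGp (Sum.inl n) = ((Subgroup.zpowers ε).map ι).topologicalClosure := fun n => by
    rw [show G.edgeGp (Sum.inl n) = G.nodeGp n from rfl, hN n, hE]
  have hEc : ∀ c', G.edgeGp (Sum.inr c') = ((Subgroup.zpowers (c 0)).map ι).topologicalClosure :=
    fun c' => by rw [show G.edgeGp (Sum.inr c') = G.cuspGp c' from rfl, hC c', hc0 c']; rfl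
  have hιε : ∀ n, ι ε ∈ G.edgeGp (Sum.inl n) := fun n => by
    rw [hEn]
    exact Subgroup.le_topologicalClosure _ (Subgroup.mem_map_of_mem ι (Subgroup.mem_zpowers ε))
  have hιc : ∀ c', ι (c 0) ∈ G.edgeGp (Sum.inr c') := fun c' => by
    rw [hEc]
    exact Subgroup.le_topologicalClosure _ (Subgroup.mem_map_of_mem ι (Subgroup.mem_zpowers _))
  intro V hVn hVo
  haveI := hVn
  refine ⟨V, hVn, hVo, le_rfl, ?_⟩
  -- the Heisenberg group mod `ℓ^m`, `m = [Π : V]`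
  have hVi : IsSigmaInteger Sigma V.index := hι.index_open V hVn hVo
  set m : ℕ := V.index with hm
  have hmpos : 0 < m := hVi.1
  obtain ⟨φH, X, Y, Z, hXYZ, hZc, hZpow, hcard⟩ := Heisenberg.exists_heisenbergTriple_central (ℓ ^ m)
  haveI : Finite (Multiplicative (ZMod (ℓ ^ m) × ZMod (ℓ ^ m)) ⋊[φH] Multiplicative (ZMod (ℓ ^ m))) :=
    Nat.finite_of_card_ne_zero (by rw [hcard]; exact pow_ne_zero _ (pow_ne_zero _ hℓ.ne_zero))
  have hHM : IsSigmaInteger Sigma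
      (Nat.card (Multiplicative (ZMod (ℓ ^ m) × ZMod (ℓ ^ m)) ⋊[φH] Multiplicative (ZMod (ℓ ^ m)))) := by
    rw [hcard, ← pow_mul]
    exact Literature.AnabelianGeometry.SemiGraphs.isSigmaInteger_prime_pow hℓ hℓS _
  have hZm : Z ^ m ≠ 1 := fun h =>
    absurd (Nat.le_of_dvd hmpos ((hZpow m).mp h)) (not_le.mpr (Nat.lt_pow_self hℓ.one_lt))
  have hZc' : X * Y * X⁻¹ * Y⁻¹ ∈ Subgroup.center _ := by rw [hXYZ]; exact hZc
  have hW : X * Y * X⁻¹ * Y⁻¹ * Z⁻¹ = 1 := by rw [hXYZ, mul_inv_cancel]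
  have h0g : (0 : ℕ) < g₀ + g₁ := by omega
  rintro (n₁ | c₁') (n₂ | c₂') γ₁ γ₂ hne12
  · -- node / node: the boundary-node theorem for `B = ⟨a_i, b_i : i ≥ g₀⟩`
    rw [hEn n₁, hEn n₂] at hne12 ⊢
    have hne' := hne12.resolve_left fun h => h (by rw [hN n₁, hN n₂])
    exact boundaryNode_exists_open_separating_sameEdge hι b₀ S_B _ rfl hg₁' θ hθinj hθB hℓ hℓS _
      (by rw [hθc]) V hVo γ₁ γ₂ hne'
  · -- alive: the node; killed: the cusp — `(a₀, b₀, a_{g₀}, b_{g₀}) ↦ (X, Y, Y, X)`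
    obtain ⟨ψ, ha, hb, -, -, hab, hcj⟩ := exists_hom_two_handles (g := g₀ + g₁) (r := 1)
      ⟨0, h0g⟩ ⟨g₀, by omega⟩ (fun h => by have := congrArg Fin.val h; simp only at this; omega) X Y hZc'
    have hψε : ψ ε = Z := by
      rw [hε, hom_two_handles_nodeLoop ψ ha hb hab hcj g₀ 0 (by simp only; omega) (by simp only; exact le_rfl),
        hXYZ]
    refine exists_open_separating_of_hom hι hHM ψ (G.edgeGp (Sum.inr c₂')) (Subgroup.zpowers (c 0))
      (hEc c₂') (fun x hx => ?_) (G.edgeGp (Sum.inl n₁)) ε (hιε n₁) V hVo (by rw [hψε]; exact hZm) γ₁ γ₂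
    obtain ⟨k, rfl⟩ := Subgroup.mem_zpowers_iff.mp hx
    rw [map_zpow, hcj 0, one_zpow]
  · -- alive: the cusp; killed: the node — `(a₀, b₀, c₀) ↦ (X, Y, Z⁻¹)`
    obtain ⟨ψ, ha, hb, hc, hab, hc'⟩ :=
      exists_hom_handle_cusp (g := g₀ + g₁) (r := 1) ⟨0, h0g⟩ 0 X Y Z⁻¹ hW
    have hψε : ψ ε = 1 := by
      rw [hε, hom_handle_cusp_nodeLoop ψ ha hb hc hab hc' g₀ 0, if_pos (Nat.zero_le _),
        if_pos (show ((⟨0, h0g⟩ : Fin (g₀ + g₁)) : ℕ) < g₀ by simp only; omega), hXYZ, inv_mul_cancel]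
    refine exists_open_separating_of_hom hι hHM ψ (G.edgeGp (Sum.inl n₂)) (Subgroup.zpowers ε)
      (hEn n₂) (fun x hx => ?_) (G.edgeGp (Sum.inr c₁')) (c 0) (hιc c₁') V hVo
      (by rw [hc, inv_pow]; exact inv_ne_one.mpr hZm) γ₁ γ₂
    obtain ⟨k, rfl⟩ := Subgroup.mem_zpowers_iff.mp hx
    rw [map_zpow, hψε, one_zpow]
  · -- cusp / cusp: the boundary-node theorem for `B = Γ_{g,1}` itself (`θ = id`, boundary `c₀`)
    have h12 : c₁' = c₂' := e.injective (by rw [hc0, hc0])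
    subst h12
    have hne' := hne12.resolve_left fun h => h rfl
    exact boundaryNode_exists_open_separating_sameEdge hι b₀ Set.univ _ rfl (by omega)
      (MonoidHom.id (PuncturedSurfaceGroup (g₀ + g₁) 1)) Function.injective_id hidB hℓ hℓS
      (G.edgeGp (Sum.inr c₁')) (by rw [MonoidHom.id_apply]; exact hEc c₁') V hVo γ₁ γ₂ hne'

/-- **Row F-2827 at EVERY two-component datum with `C₁` unmarked, `r ≥ 1`**: gen 5's level route for
`r ≥ 2` (`edgeLikeSeparatingCoverings_of_twoComponentUnmarked`) and the one-cusp theorem above.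
[cite: MochizukiCombGC2007, Prop 1.2 proof p.9] -/
theorem edgeLikeSeparatingCoverings_of_twoComponentUnmarked' (hne : Sigma.Nonempty)
    (hprime : ∀ p ∈ Sigma, p.Prime) (ι : PuncturedSurfaceGroup g r →* P)
    (hι : IsProSigmaCompletion Sigma ι) (G : PSCDatum P) {g₀ s : ℕ} (hg₀ : g₀ ≤ g) (hs : s = 0)
    (hr : 1 ≤ r) (hst₀ : 1 ≤ g₀ ∨ 2 ≤ r) (hg₁ : 1 ≤ g - g₀) (e : G.graph.C ≃ Fin r)
    (hC : ∀ c', G.cuspGp c' = ((cuspInertia (g := g) (e c')).map ι).topologicalClosure)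
    (ε : PuncturedSurfaceGroup g r)
    (hε : ε = ((List.finRange r).map fun j : Fin r =>
          if s ≤ (j : ℕ) then PuncturedSurfaceGroup.c (g := g) j else 1).prod *
        ((List.finRange g).map fun i : Fin g => if (i : ℕ) < g₀ then
          PuncturedSurfaceGroup.a (r := r) i * PuncturedSurfaceGroup.b i *
            (PuncturedSurfaceGroup.a i)⁻¹ * (PuncturedSurfaceGroup.b i)⁻¹ else 1).prod)
    (n₀ : G.graph.N) (hN : ∀ n, n = n₀)
    (hE : G.nodeGp n₀ = ((Subgroup.zpowers ε).map ι).topologicalClosure) :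
    G.EdgeLikeSeparatingCoverings := by
  by_cases h2 : 2 ≤ r
  · exact G.edgeLikeSeparatingCoverings_of_twoComponentUnmarked hne hprime ι hι hg₀ hs h2 hg₁ e hC ε hε n₀ hN hE
  · exact G.edgeLikeSeparatingCoverings_of_twoComponentUnmarked_oneCusp hne hprime ι hι hs (by omega)
      (by rcases hst₀ with h | h <;> omega) hg₁ e hC ε hε n₀ hN hE

/-- **Row F-2829 `SeparatingCoverings` — all three conjuncts — at EVERY two-component datum with `C₁`
unmarked, `r ≥ 1`**: ⟨F-2826 abc-iut-f-164 `verticialSeparatingCoverings_of_twoComponentUnmarked`, F-2827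
above, F-2828 abc-iut-f-164 `unrRows_of_twoComponent`⟩. [cite: MochizukiCombGC2007, Prop 1.2 proof p.9] -/
theorem separatingCoverings_of_twoComponentUnmarked' (hne : Sigma.Nonempty)
    (hprime : ∀ p ∈ Sigma, p.Prime) (ι : PuncturedSurfaceGroup g r →* P)
    (hι : IsProSigmaCompletion Sigma ι) (G : PSCDatum P) {g₀ s : ℕ} (hg₀ : g₀ ≤ g) (hs : s = 0)
    (hr : 1 ≤ r) (hst₀ : 1 ≤ g₀ ∨ 2 ≤ r) (hg₁ : 1 ≤ g - g₀) (e : G.graph.C ≃ Fin r)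
    (hC : ∀ c', G.cuspGp c' = ((cuspInertia (g := g) (e c')).map ι).topologicalClosure)
    (v₀ v₁ : G.graph.V) (hV : ∀ w, w = v₀ ∨ w = v₁) (ε : PuncturedSurfaceGroup g r)
    (hε : ε = ((List.finRange r).map fun j : Fin r =>
          if s ≤ (j : ℕ) then PuncturedSurfaceGroup.c (g := g) j else 1).prod *
        ((List.finRange g).map fun i : Fin g => if (i : ℕ) < g₀ then
          PuncturedSurfaceGroup.a (r := r) i * PuncturedSurfaceGroup.b i *
            (PuncturedSurfaceGroup.a i)⁻¹ * (PuncturedSurfaceGroup.b i)⁻¹ else 1).prod)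
    (hV₀ : G.vertGp v₀ = ((Subgroup.closure {x : PuncturedSurfaceGroup g r |
        (∃ i : Fin g, (i : ℕ) < g₀ ∧ (x = PuncturedSurfaceGroup.a i ∨ x = PuncturedSurfaceGroup.b i)) ∨
        ∃ j : Fin r, s ≤ (j : ℕ) ∧ x = PuncturedSurfaceGroup.c j}).map ι).topologicalClosure)
    (hV₁ : G.vertGp v₁ = ((Subgroup.closure {x : PuncturedSurfaceGroup g r |
        (∃ i : Fin g, g₀ ≤ (i : ℕ) ∧ (x = PuncturedSurfaceGroup.a i ∨ x = PuncturedSurfaceGroup.b i)) ∨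
        (∃ j : Fin r, (j : ℕ) < s ∧ x = PuncturedSurfaceGroup.c j) ∨ x = ε}).map ι).topologicalClosure)
    (n₀ : G.graph.N) (hN : ∀ n, n = n₀)
    (hE : G.nodeGp n₀ = ((Subgroup.zpowers ε).map ι).topologicalClosure)
    (hgen₀ : G.genus v₀ = g₀) (hgen₁ : G.genus v₁ = g - g₀) : G.SeparatingCoverings :=
  ⟨G.verticialSeparatingCoverings_of_twoComponentUnmarked hne hprime ι hι hs hr hst₀ hg₁ v₀ v₁ hV ε hε hV₀ hV₁,
    G.edgeLikeSeparatingCoverings_of_twoComponentUnmarked' hne hprime ι hι hg₀ hs hr hst₀ hg₁ e hC ε hε n₀ hN hE,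
    (G.unrRows_of_twoComponent hne hprime ι hι e hC n₀ hN v₀ v₁ hV ε hε hV₀ hV₁ hE hgen₀ hgen₁).1⟩

end Datum

end PSCDatum

end Literature.AnabelianGeometry.SemiGraphs

end
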